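import Literature.AlgebraicGeometry.ModuliOfAbelianVarieties.SiegelModuliHumbertSurfaces
import Literature.AlgebraicGeometry.ModuliOfAbelianVarieties.SiegelFamilyHilbertModularGroup
import HarnessLib

/-!
# The Humbert surface `H_Δ ⊂ 𝒜₂` is the image of the Hilbert modular surface `SL(O ⊕ O^∨)\(ℍ × ℍ)` under the map
# induced by Runge's modular embedding ("by taking the quotient `Γ(F)\H(F)`, we get the standard model")

Layer `Literature/AlgebraicGeometry/ModuliOfAbelianVarieties`, namespace
`Literature.AlgebraicGeometry.ModuliOfAbelianVarieties.SiegelModuli`; lane `lit-hodgefound` (Track 2 foundations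
library, Layer A4), seat `lit-hodgefound-skel-4`, row **A4-70**, FILE 5 (rider; definitions with bodies + theorems,
no named fact). Joins FILE 2 (`SiegelModuliHumbertSurfaces`: `siegelThreefold = Sp₄(ℤ)\𝔥₂`, `siegelThreefold.mk`,
`mk_smul`, `humbertSurface Δ`, `humbertSurface_eq_range`, `humbertSurface_eq_range_ediv_emod`) with FILE 4
(`SiegelFamilyHilbertModularGroup`: `hilbertModularPairGroup k l hΔ = SL(O ⊕ O^∨)` through its two real embeddings,
`exists_gDHom_smul_eq_modularEmbedding_smul`), all BY NAME.

## Sources, verbatim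

B. Runge, Tohoku Math. J. 51 (1999), §4 p. 291 (held `paper:doi-10-2748-tmj-1178224764` p0009): "By the last theorem
any period `τ = π[R]` with `O ⊂ End(Λ_τ)` lies in a manifold `H(F)` as constructed above. By taking the quotient
`Γ(F)\H(F)`, we get the standard model for Humbert surfaces. The Humbert modular group `Γ(F) = Γ(Δ)` is described in
the following lemma." K. Hashimoto, N. Murabayashi, Tohoku Math. J. 47 (1995), Prop. 3.7: "Each point of `H_Δ` can
be represented by `τ ∈ 𝔥₂` satisfying `aτ₁ + bτ₂ + τ₃ = 0` …". N. Elkies, A. Kumar, Algebra & Number Theory 8 (2014),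
§3 (held `paper:arxiv-1209.3527` p0009): "the moduli space of abelian surfaces with real multiplication is
`SL₂(O_D, O_D^*)\(ℍ⁺ × ℍ⁺)` … The construction above yields a map … to the quotient of `𝔖₂`, the Siegel upper half
space of degree `2`, by the arithmetic group `Sp₄(ℤ)`"; §1 (p0004): "The image … is the Humbert surface corresponding
to discriminant `D`. The Hilbert modular surface `Y₋(D)` itself is a double cover of the Humbert surface".
Convention: Elkies–Kumar print `SL₂(O_D, O_D^*)` with `c ∈ O_D^*`, `b ∈ (O_D^*)⁻¹` (column vectors); FILE 4's
`hilbertModularPairGroup` is the transposed presentation `b ∈ O^∨`, `c ∈ (O^∨)⁻¹` forced by Runge's `π[R]` and the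
tree's action `(αZ + β)(γZ + δ)⁻¹` — the same abstract group `SL(O ⊕ O^∨)`.

## What is proved (definitions with bodies + theorems; NO named fact, NO sorry, net debt 0)

* **`siegelThreefold.mk_modularEmbedding_smul`**: `[π[R](g·τ)] = [π[R](τ)]` in `𝒜₂` for `g ∈ SL(O ⊕ O^∨)`.
* **`hilbertModularSurface k l hΔ := SL(O ⊕ O^∨)\(ℍ × ℍ)`** (orbit space, quotient topology), `hilbertModularSurface.mk`,
  `continuous_mk`, `mk_surjective`, `mk_smul`.
* **`hilbertToSiegel k l hΔ : SL(O ⊕ O^∨)\ℍ² → 𝒜₂`, `[τ] ↦ [π[R](τ)]`** (well defined by the previous item),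
  `hilbertToSiegel_mk`, **`continuous_hilbertToSiegel`**, **`range_hilbertToSiegel`** (`= humbertSurface (l² + 4k)`:
  THE HUMBERT SURFACE IS THE IMAGE OF THE HILBERT MODULAR SURFACE), **`humbertSurface_eq_range_hilbertToSiegel`**
  (every `H_Δ`, `Δ > 0`, `Δ ≡ 0, 1 (4)`, is such an image, with `(k, l) = (Δ/4, Δ % 4)`).

Scope: the degree (generically `2`, Elkies–Kumar "double cover") and the analytic structure are not formalised.
-/

noncomputable section

namespace Literature.AlgebraicGeometry.ModuliOfAbelianVarieties.SiegelModuli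

open Matrix Function Set Topology
open scoped UpperHalfPlane
open Literature.NumberTheory.Automorphic Literature.NumberTheory.ModularForms.SiegelUpperHalfSpace

variable {k l : ℤ}

/-! ## §1 `[π[R](g·τ)] = [π[R](τ)]` for `g ∈ SL(O ⊕ O^∨)` -/

/-- **`[π[R](g·τ)] = [π[R](τ)]` in `𝒜₂ = Sp₄(ℤ)\𝔥₂` for every `g ∈ SL(O ⊕ O^∨)`.** [cite: Runge1999EndomorphismRingsAbelianSurfaces, §4 p. 291] [cite: ElkiesKumar2014HilbertModularSurfaces, §3] -/
theorem siegelThreefold.mk_modularEmbedding_smul (hΔ : 0 < quadDisc k l)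
    {g : Fin 2 → Matrix.SpecialLinearGroup (Fin 2) ℝ} (hg : g ∈ hilbertModularPairGroup k l hΔ) (τ : Fin 2 → ℍ) :
    siegelThreefold.mk (modularEmbedding k l hΔ (fun s ↦ g s • τ s)) = siegelThreefold.mk (modularEmbedding k l hΔ τ) := by
  obtain ⟨M, hM⟩ := exists_gDHom_smul_eq_modularEmbedding_smul hΔ hg τ
  rw [hM, siegelThreefold.mk_smul]

/-! ## §2 The Hilbert modular surface `SL(O ⊕ O^∨)\(ℍ × ℍ)` and its map to `𝒜₂` -/

/-- The orbit relation of `SL(O ⊕ O^∨)` (as the subgroup `hilbertModularPairGroup` of `SL₂(ℝ)²`) on `ℍ × ℍ`.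
[cite: ElkiesKumar2014HilbertModularSurfaces, §3] -/
abbrev hilbertModularSurface.setoid (k l : ℤ) (hΔ : 0 < quadDisc k l) : Setoid (Fin 2 → ℍ) :=
  MulAction.orbitRel (hilbertModularPairGroup k l hΔ) (Fin 2 → ℍ)

/-- **The Hilbert modular surface `X = SL(O ⊕ O^∨)\(ℍ × ℍ)` of the order `O = ℤ[ω]`, `ω² = lω + k`** (as an orbit space
with the quotient topology). [cite: ElkiesKumar2014HilbertModularSurfaces, §3] [cite: Runge1999EndomorphismRingsAbelianSurfaces, §4 p. 291 (`Γ(F)\H(F)`)] -/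
abbrev hilbertModularSurface (k l : ℤ) (hΔ : 0 < quadDisc k l) : Type :=
  Quotient (hilbertModularSurface.setoid k l hΔ)

/-- The canonical map `ℍ × ℍ → X`. [cite: ElkiesKumar2014HilbertModularSurfaces, §3] -/
def hilbertModularSurface.mk (k l : ℤ) (hΔ : 0 < quadDisc k l) (τ : Fin 2 → ℍ) : hilbertModularSurface k l hΔ :=
  Quotient.mk (hilbertModularSurface.setoid k l hΔ) τ

/-- `ℍ × ℍ → X` is continuous. [cite: ElkiesKumar2014HilbertModularSurfaces, §3] -/
theorem hilbertModularSurface.continuous_mk (hΔ : 0 < quadDisc k l) : Continuous (hilbertModularSurface.mk k l hΔ) :=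
  continuous_quotient_mk'

/-- `ℍ × ℍ → X` is onto. [cite: ElkiesKumar2014HilbertModularSurfaces, §3] -/
theorem hilbertModularSurface.mk_surjective (hΔ : 0 < quadDisc k l) : Surjective (hilbertModularSurface.mk k l hΔ) :=
  Quotient.mk_surjective

/-- `[γ·τ] = [τ]` in `X` for `γ ∈ SL(O ⊕ O^∨)`. [cite: ElkiesKumar2014HilbertModularSurfaces, §3] -/
theorem hilbertModularSurface.mk_smul (hΔ : 0 < quadDisc k l) (γ : hilbertModularPairGroup k l hΔ) (τ : Fin 2 → ℍ) :
    hilbertModularSurface.mk k l hΔ (γ • τ) = hilbertModularSurface.mk k l hΔ τ :=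
  Quotient.sound (MulAction.orbitRel_apply.2 (MulAction.mem_orbit τ γ))

/-- **The map `X = SL(O ⊕ O^∨)\(ℍ × ℍ) → 𝒜₂ = Sp₄(ℤ)\𝔥₂`, `[τ] ↦ [π[R](τ)]`, induced by Runge's modular embedding**
(well defined by `siegelThreefold.mk_modularEmbedding_smul`). [cite: Runge1999EndomorphismRingsAbelianSurfaces, §4 p. 291] [cite: ElkiesKumar2014HilbertModularSurfaces, §3] -/
def hilbertToSiegel (k l : ℤ) (hΔ : 0 < quadDisc k l) : hilbertModularSurface k l hΔ → siegelThreefold :=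
  Quotient.lift (fun τ ↦ siegelThreefold.mk (modularEmbedding k l hΔ τ)) (by
    rintro τ τ' ⟨γ, rfl⟩
    exact siegelThreefold.mk_modularEmbedding_smul hΔ γ.2 τ')

/-- `hilbertToSiegel [τ] = [π[R](τ)]`. [cite: Runge1999EndomorphismRingsAbelianSurfaces, §4 p. 291] -/
@[simp] theorem hilbertToSiegel_mk (hΔ : 0 < quadDisc k l) (τ : Fin 2 → ℍ) :
    hilbertToSiegel k l hΔ (hilbertModularSurface.mk k l hΔ τ) = siegelThreefold.mk (modularEmbedding k l hΔ τ) := rfl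

/-- `X → 𝒜₂` is continuous. [cite: ElkiesKumar2014HilbertModularSurfaces, §3] -/
theorem continuous_hilbertToSiegel (hΔ : 0 < quadDisc k l) : Continuous (hilbertToSiegel k l hΔ) :=
  Continuous.quotient_lift (siegelThreefold.continuous_mk.comp (continuous_modularEmbedding hΔ)) _

/-- **THE HUMBERT SURFACE IS THE IMAGE OF THE HILBERT MODULAR SURFACE: `range (X → 𝒜₂) = H_{l² + 4k}`.**
[cite: Runge1999EndomorphismRingsAbelianSurfaces, §4 p. 291] [cite: HashimotoMurabayashi1995, Prop. 3.7] [cite: ElkiesKumar2014HilbertModularSurfaces, §1 and §3] -/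
theorem range_hilbertToSiegel (hΔ : 0 < quadDisc k l) :
    Set.range (hilbertToSiegel k l hΔ) = humbertSurface (quadDisc k l) := by
  rw [humbertSurface_eq_range hΔ]
  ext x
  constructor
  · rintro ⟨t, rfl⟩
    induction t using Quotient.inductionOn with
    | h τ => exact ⟨τ, rfl⟩
  · rintro ⟨τ, rfl⟩
    exact ⟨hilbertModularSurface.mk k l hΔ τ, rfl⟩

/-- `X → H_Δ` is onto: every point of the Humbert surface comes from the Hilbert modular surface.
[cite: HashimotoMurabayashi1995, Prop. 3.7] [cite: ElkiesKumar2014HilbertModularSurfaces, §3] -/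
theorem exists_hilbertToSiegel_eq (hΔ : 0 < quadDisc k l) {x : siegelThreefold} (hx : x ∈ humbertSurface (quadDisc k l)) :
    ∃ t : hilbertModularSurface k l hΔ, hilbertToSiegel k l hΔ t = x := by
  rwa [← range_hilbertToSiegel hΔ] at hx

/-- **Every Humbert surface `H_Δ` (`Δ > 0`, `Δ ≡ 0, 1 (mod 4)`) is the image of the Hilbert modular surface of the order
of discriminant `Δ`** (`(k, l) = (Δ/4, Δ % 4)`, `l² + 4k = Δ`). [cite: Runge1999EndomorphismRingsAbelianSurfaces, §4 p. 291] [cite: HashimotoMurabayashi1995, Def. 3.6 and Prop. 3.7] -/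
theorem humbertSurface_eq_range_hilbertToSiegel {Δ : ℤ} (hpos : 0 < Δ) (hmod : Δ % 4 = 0 ∨ Δ % 4 = 1) :
    humbertSurface Δ =
      Set.range (hilbertToSiegel (Δ / 4) (Δ % 4) (by rw [quadDisc_ediv_emod hmod]; exact hpos)) := by
  rw [range_hilbertToSiegel, quadDisc_ediv_emod hmod]

end Literature.AlgebraicGeometry.ModuliOfAbelianVarieties.SiegelModuli

end
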